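import Mathlib
import Summits.ResolutionOfSingularities.ResolutionOfSingularities.Theorems.WeightedInvariantLocalWeightedDropPureDescentDefs
import Summits.ResolutionOfSingularities.ResolutionOfSingularities.Theorems.WeightedInvariantLocalWeightedDropNewtonSetChartLaws
import Summits.ResolutionOfSingularities.ResolutionOfSingularities.Theorems.WeightedInvariantLocalWeightedDropMonicDescentTransportLaws
import Summits.ResolutionOfSingularities.ResolutionOfSingularities.Theorems.WeightedInvariantLocalWeightedDropMonicDescentShearNewton
import Literature.RingTheory.MvPowerSeries.FrobeniusPowerBasis

/-!
# `WeightedInvariant.LocalWeightedDrop`, stub S3πM: the pure-power polyhedron descent — SUPPORT TRANSPORTS and CLEANNESS under the four monomial moves (piece P-N)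

Crux item stmt-ResolutionOfSingularities-8899 `LocalWeightedDrop` (route `ResolutionOfSingularities/WeightedInvariant`), registered skeleton v29
(4058ce51dfd2e5c8), stub S3πM `stub_wildPurelyInseparableReductionWon`.  [OURS · L1 W4.3, chain w43, lead prover (gen 3); a LINE UNDER THE STUB: the
pure-power polyhedron descent (second key to S3πM), MODEL Cossart–Jannsen–Saito LNM 2270 Ch. 11–13 for `J = (y^q + A)`, `e = 2`, `k = k̄` — the
degree-2 instance is the landed key N4″ (`…Theorems.MonicDescent*`); nothing here is a statement of any manuscript.]

* `nset_blowOne/Two` — the support under the two point-blow-up charts is `psi q '' nset` / `phiE q '' nset` (positions); `nset_divOne/Two` — under the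
  curve blow-ups it is the shift by `(q,0)` / `(0,q)` (permissible labels), with the coordinate identities `shiftOneQ_*`/`shiftTwoQ_*` that feed the
  def-free shift laws of `…NewtonSetChartLaws`;
* `clean_blowOne/Two/divOne/divTwo` — CLEANING COMMUTES with the four transports (they respect the lattice `(qℕ)²`), hence clean labels stay clean;
* `clean_add_pow` — Frobenius: `clean (A + φ^{p^e}) = clean A` (the clean part is an invariant of the re-centring class);
* `isPosition_clean`, `le_sum_of_isPosition`, `alphaL_lt_of_not_isPermissibleOne`, `epsL_lt_of_not_isPermissibleTwo`, `isPermissibleTwo_of_le_epsL`, ….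
-/

set_option linter.dupNamespace false -- mandated namespace of this single-conjunct summit

noncomputable section

namespace Summit.ResolutionOfSingularities.ResolutionOfSingularities.Theorems

namespace PureDescent

open MvPowerSeries MonicDescent Literature.RingTheory.TwoVariableSeries

variable {k : Type} [Field k]

/-! ## Non-emptiness -/

/-- The support is non-empty iff the series is non-zero. -/
theorem nset_nonempty_iff (A : MvPowerSeries (Fin 2) k) : (nset A).Nonempty ↔ A ≠ 0 := by
  constructor
  · rintro ⟨P, hP⟩ rfl
    exact hP (map_zero _)
  · intro hA
    by_contra hne
    apply hA
    ext P
    rw [map_zero]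
    by_contra hP
    exact hne ⟨P, hP⟩

/-! ## The support under the four monomial transports -/

/-- `u₁`-CHART: the support of `blowOne q A` is `psi q '' nset A` when every point has `P₀ + P₁ ≥ q`. -/
theorem nset_blowOne (q : ℕ) (A : MvPowerSeries (Fin 2) k) (hA : ∀ P ∈ nset A, q ≤ P 0 + P 1) :
    nset (blowOne q A) = psi q '' nset A := by
  ext d
  rw [mem_nset_iff]
  constructor
  · intro hd
    obtain ⟨e, -, rfl, he⟩ := exists_of_coeff_blowOne_ne_zero q A d hd
    exact ⟨e, he, rfl⟩
  · rintro ⟨e, he, rfl⟩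
    rw [coeff_blowOne_psi q A e (hA e he)]
    exact he

/-- `u₂`-CHART: the support of `blowTwo q A` is `phiE q '' nset A` when every point has `P₀ + P₁ ≥ q`. -/
theorem nset_blowTwo (q : ℕ) (A : MvPowerSeries (Fin 2) k) (hA : ∀ P ∈ nset A, q ≤ P 0 + P 1) :
    nset (blowTwo q A) = phiE q '' nset A := by
  ext d
  rw [mem_nset_iff]
  constructor
  · intro hd
    obtain ⟨e, -, rfl, he⟩ := exists_of_coeff_blowTwo_ne_zero q A d hd
    exact ⟨e, he, rfl⟩
  · rintro ⟨e, he, rfl⟩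
    rw [coeff_blowTwo_phiE q A e (hA e he)]
    exact he

/-- CURVE `V(y,u₁)`: the support of `divOne q A` is the shift `P ↦ P − (q,0)` of `nset A` when `u₁^q ∣ A`. -/
theorem nset_divOne (q : ℕ) (A : MvPowerSeries (Fin 2) k) (hA : IsPermissibleOne q A) :
    nset (divOne q A) = (fun P : Fin 2 →₀ ℕ => Finsupp.single 0 (P 0 - q) + Finsupp.single 1 (P 1)) '' nset A := by
  ext d
  rw [mem_nset_iff]
  constructor
  · intro hd
    rw [coeff_divOne] at hd
    refine ⟨d + Finsupp.single 0 q, hd, finsupp_fin2_ext ?_ ?_⟩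
    · simp only [Finsupp.add_apply, Finsupp.single_apply]
      simp
    · simp only [Finsupp.add_apply, Finsupp.single_apply]
      simp
  · rintro ⟨e, he, rfl⟩
    rw [coeff_divOne_shift q A e (hA e he)]
    exact he

/-- CURVE `V(y,u₂)`: the support of `divTwo q A` is the shift `P ↦ P − (0,q)` of `nset A` when `u₂^q ∣ A`. -/
theorem nset_divTwo (q : ℕ) (A : MvPowerSeries (Fin 2) k) (hA : IsPermissibleTwo q A) :
    nset (divTwo q A) = (fun P : Fin 2 →₀ ℕ => Finsupp.single 0 (P 0) + Finsupp.single 1 (P 1 - q)) '' nset A := by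
  ext d
  rw [mem_nset_iff]
  constructor
  · intro hd
    rw [coeff_divTwo] at hd
    refine ⟨d + Finsupp.single 1 q, hd, finsupp_fin2_ext ?_ ?_⟩
    · simp only [Finsupp.add_apply, Finsupp.single_apply]
      simp
    · simp only [Finsupp.add_apply, Finsupp.single_apply]
      simp
  · rintro ⟨e, he, rfl⟩
    rw [coeff_divTwo_shift q A e (hA e he)]
    exact he

/-- The first shift on permissible supports: `σ P 0 + q = P 0`. -/
theorem shiftOneQ_fst {q : ℕ} {A : MvPowerSeries (Fin 2) k} (hA : IsPermissibleOne q A) :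
    ∀ P ∈ nset A, (Finsupp.single 0 (P 0 - q) + Finsupp.single 1 (P 1) : Fin 2 →₀ ℕ) 0 + q = P 0 := by
  intro P hP
  have h := hA P hP
  simp only [Finsupp.add_apply, Finsupp.single_apply]
  simp
  omega

/-- The first shift keeps the second coordinate. -/
theorem shiftOneQ_snd (q : ℕ) (A : MvPowerSeries (Fin 2) k) :
    ∀ P ∈ nset A, (Finsupp.single 0 (P 0 - q) + Finsupp.single 1 (P 1) : Fin 2 →₀ ℕ) 1 = P 1 := by
  intro P _
  simp only [Finsupp.add_apply, Finsupp.single_apply]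
  simp

/-- The second shift keeps the first coordinate. -/
theorem shiftTwoQ_fst (q : ℕ) (A : MvPowerSeries (Fin 2) k) :
    ∀ P ∈ nset A, (Finsupp.single 0 (P 0) + Finsupp.single 1 (P 1 - q) : Fin 2 →₀ ℕ) 0 = P 0 := by
  intro P _
  simp only [Finsupp.add_apply, Finsupp.single_apply]
  simp

/-- The second shift on permissible supports: `σ P 1 + q = P 1`. -/
theorem shiftTwoQ_snd {q : ℕ} {A : MvPowerSeries (Fin 2) k} (hA : IsPermissibleTwo q A) :
    ∀ P ∈ nset A, (Finsupp.single 0 (P 0) + Finsupp.single 1 (P 1 - q) : Fin 2 →₀ ℕ) 1 + q = P 1 := by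
  intro P hP
  have h := hA P hP
  simp only [Finsupp.add_apply, Finsupp.single_apply]
  simp
  omega

/-! ## Cleanness under the four transports -/

/-- Parity of `psi q e` (`e₀ + e₁ ≥ q`): both coordinates divisible by `q` iff both coordinates of `e` are. -/
theorem forall_dvd_psi_iff (q : ℕ) {e : Fin 2 →₀ ℕ} (he : q ≤ e 0 + e 1) :
    (∀ i, q ∣ psi q e i) ↔ ∀ i, q ∣ e i := by
  constructor
  · intro h i
    have h0 := h 0; have h1 := h 1
    rw [psi_apply_zero] at h0; rw [psi_apply_one] at h1
    fin_cases i
    · have : e 0 = (e 0 + e 1 - q) + q - e 1 := by omega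
      show q ∣ e 0
      rw [this]
      exact Nat.dvd_sub (Nat.dvd_add h0 (dvd_refl q)) h1
    · exact h1
  · intro h i
    fin_cases i
    · show q ∣ psi q e 0
      rw [psi_apply_zero]
      exact Nat.dvd_sub (Nat.dvd_add (h 0) (h 1)) (dvd_refl q)
    · show q ∣ psi q e 1
      rw [psi_apply_one]; exact h 1

/-- Parity of `phiE q e` (`e₀ + e₁ ≥ q`). -/
theorem forall_dvd_phiE_iff (q : ℕ) {e : Fin 2 →₀ ℕ} (he : q ≤ e 0 + e 1) :
    (∀ i, q ∣ phiE q e i) ↔ ∀ i, q ∣ e i := by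
  constructor
  · intro h i
    have h0 := h 0; have h1 := h 1
    rw [phiE_apply_zero] at h0; rw [phiE_apply_one] at h1
    fin_cases i
    · exact h0
    · have : e 1 = (e 0 + e 1 - q) + q - e 0 := by omega
      show q ∣ e 1
      rw [this]
      exact Nat.dvd_sub (Nat.dvd_add h1 (dvd_refl q)) h0
  · intro h i
    fin_cases i
    · show q ∣ phiE q e 0
      rw [phiE_apply_zero]; exact h 0
    · show q ∣ phiE q e 1
      rw [phiE_apply_one]
      exact Nat.dvd_sub (Nat.dvd_add (h 0) (h 1)) (dvd_refl q)

/-- CLEANING COMMUTES WITH THE `u₁`-CHART (monomials of total degree `< q` are dropped by the chart; on the others `psi q` keeps the parity). -/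
theorem clean_blowOne (q : ℕ) (A : MvPowerSeries (Fin 2) k) : clean q (blowOne q A) = blowOne q (clean q A) := by
  ext d
  by_cases hd : coeff d (blowOne q A) = 0
  · -- then also `coeff d (blowOne q (clean q A)) = 0`
    have hd' : coeff d (blowOne q (clean q A)) = 0 := by
      by_contra hne
      obtain ⟨e, he, rfl, hec⟩ := exists_of_coeff_blowOne_ne_zero q (clean q A) _ hne
      have heA : coeff e A ≠ 0 := nset_clean_subset q A hec
      rw [coeff_blowOne_psi q A e he] at hd
      exact heA hd
    rw [hd', coeff_clean, hd]
    split_ifs <;> rfl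
  · obtain ⟨e, he, rfl, heA⟩ := exists_of_coeff_blowOne_ne_zero q A d hd
    rw [coeff_clean, coeff_blowOne_psi q A e he, coeff_blowOne_psi q (clean q A) e he, coeff_clean]
    by_cases hdiv : ∀ i, q ∣ e i
    · rw [if_pos ((forall_dvd_psi_iff q he).mpr hdiv), if_pos hdiv]
    · rw [if_neg (fun h => hdiv ((forall_dvd_psi_iff q he).mp h)), if_neg hdiv]

/-- CLEANING COMMUTES WITH THE `u₂`-CHART. -/
theorem clean_blowTwo (q : ℕ) (A : MvPowerSeries (Fin 2) k) : clean q (blowTwo q A) = blowTwo q (clean q A) := by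
  ext d
  by_cases hd : coeff d (blowTwo q A) = 0
  · have hd' : coeff d (blowTwo q (clean q A)) = 0 := by
      by_contra hne
      obtain ⟨e, he, rfl, hec⟩ := exists_of_coeff_blowTwo_ne_zero q (clean q A) _ hne
      have heA : coeff e A ≠ 0 := nset_clean_subset q A hec
      rw [coeff_blowTwo_phiE q A e he] at hd
      exact heA hd
    rw [hd', coeff_clean, hd]
    split_ifs <;> rfl
  · obtain ⟨e, he, rfl, heA⟩ := exists_of_coeff_blowTwo_ne_zero q A d hd
    rw [coeff_clean, coeff_blowTwo_phiE q A e he, coeff_blowTwo_phiE q (clean q A) e he, coeff_clean]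
    by_cases hdiv : ∀ i, q ∣ e i
    · rw [if_pos ((forall_dvd_phiE_iff q he).mpr hdiv), if_pos hdiv]
    · rw [if_neg (fun h => hdiv ((forall_dvd_phiE_iff q he).mp h)), if_neg hdiv]

/-- CLEANING COMMUTES WITH THE CURVE BLOW-UP of `V(y,u₁)` (no hypothesis: a shift by `(q,0)` keeps the parity). -/
theorem clean_divOne (q : ℕ) (A : MvPowerSeries (Fin 2) k) : clean q (divOne q A) = divOne q (clean q A) := by
  ext d
  rw [coeff_clean, coeff_divOne, coeff_divOne, coeff_clean]
  have hiff : (∀ i, q ∣ d i) ↔ ∀ i, q ∣ (d + Finsupp.single 0 q : Fin 2 →₀ ℕ) i := by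
    constructor
    · intro h i
      rw [Finsupp.add_apply]
      fin_cases i
      · exact Nat.dvd_add (h 0) (by simp)
      · simpa using h 1
    · intro h i
      have hi := h i
      rw [Finsupp.add_apply] at hi
      fin_cases i
      · have : q ∣ d 0 + q := by simpa using hi
        exact (Nat.dvd_add_right (dvd_refl q)).mp (by rwa [add_comm] at this)
      · simpa using hi
  by_cases hdiv : ∀ i, q ∣ d i
  · rw [if_pos hdiv, if_pos (hiff.mp hdiv)]
  · rw [if_neg hdiv, if_neg (fun h => hdiv (hiff.mpr h))]

/-- CLEANING COMMUTES WITH THE CURVE BLOW-UP of `V(y,u₂)`. -/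
theorem clean_divTwo (q : ℕ) (A : MvPowerSeries (Fin 2) k) : clean q (divTwo q A) = divTwo q (clean q A) := by
  ext d
  rw [coeff_clean, coeff_divTwo, coeff_divTwo, coeff_clean]
  have hiff : (∀ i, q ∣ d i) ↔ ∀ i, q ∣ (d + Finsupp.single 1 q : Fin 2 →₀ ℕ) i := by
    constructor
    · intro h i
      rw [Finsupp.add_apply]
      fin_cases i
      · simpa using h 0
      · exact Nat.dvd_add (h 1) (by simp)
    · intro h i
      have hi := h i
      rw [Finsupp.add_apply] at hi
      fin_cases i
      · simpa using hi
      · have : q ∣ d 1 + q := by simpa using hi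
        exact (Nat.dvd_add_right (dvd_refl q)).mp (by rwa [add_comm] at this)
  by_cases hdiv : ∀ i, q ∣ d i
  · rw [if_pos hdiv, if_pos (hiff.mp hdiv)]
  · rw [if_neg hdiv, if_neg (fun h => hdiv (hiff.mpr h))]

/-- A clean label stays clean under the `u₁`-chart. -/
theorem isClean_blowOne {q : ℕ} {A : MvPowerSeries (Fin 2) k} (hc : IsClean q A) : IsClean q (blowOne q A) := by
  have h := clean_blowOne q A
  rw [clean_eq_self_of_isClean hc] at h
  rw [← h]; exact isClean_clean q _

/-- A clean label stays clean under the `u₂`-chart. -/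
theorem isClean_blowTwo {q : ℕ} {A : MvPowerSeries (Fin 2) k} (hc : IsClean q A) : IsClean q (blowTwo q A) := by
  have h := clean_blowTwo q A
  rw [clean_eq_self_of_isClean hc] at h
  rw [← h]; exact isClean_clean q _

/-- A clean label stays clean under `divOne q`. -/
theorem isClean_divOne {q : ℕ} {A : MvPowerSeries (Fin 2) k} (hc : IsClean q A) : IsClean q (divOne q A) := by
  have h := clean_divOne q A
  rw [clean_eq_self_of_isClean hc] at h
  rw [← h]; exact isClean_clean q _

/-- A clean label stays clean under `divTwo q`. -/
theorem isClean_divTwo {q : ℕ} {A : MvPowerSeries (Fin 2) k} (hc : IsClean q A) : IsClean q (divTwo q A) := by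
  have h := clean_divTwo q A
  rw [clean_eq_self_of_isClean hc] at h
  rw [← h]; exact isClean_clean q _

/-! ## Frobenius: a `q`-th power has no clean part -/

/-- In characteristic `p`, `φ^{p^e}` is supported on the lattice `(p^e ℕ)²`, so `clean (A + φ^{p^e}) = clean A`: the clean part is an
invariant of the re-centring class of the position `y^{p^e} + A`. -/
theorem clean_add_pow (p : ℕ) (hp : p.Prime) [CharP k p] (e : ℕ) (A φ : MvPowerSeries (Fin 2) k) :
    clean (p ^ e) (A + φ ^ (p ^ e)) = clean (p ^ e) A := by
  haveI := Fact.mk hp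
  haveI : ExpChar k p := ExpChar.prime hp
  rw [clean_add, clean_eq_zero_of_lattice (Literature.RingTheory.MvPowerSeries.isSupportedOnMultiples_pow p φ e), add_zero]

/-! ## Positions -/

/-- A sub-supported series of a position is a position: in particular the clean part. -/
theorem isPosition_clean {q : ℕ} {A : MvPowerSeries (Fin 2) k} (hA : IsPosition q A) : IsPosition q (clean q A) :=
  isPosition_of_succ_le_sum fun P hP => succ_le_sum_of_isPosition hA P (nset_clean_subset q A hP)

/-- For a position, every support point has `P₀ + P₁ ≥ q` (the weak form used by the chart laws). -/
theorem le_sum_of_isPosition {q : ℕ} {A : MvPowerSeries (Fin 2) k} (hA : IsPosition q A) : ∀ P ∈ nset A, q ≤ P 0 + P 1 :=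
  fun P hP => le_of_lt (succ_le_sum_of_isPosition hA P hP)

/-- If `V(y,u₁)` is NOT permissible for a non-zero label then `α ≤ q − 1`. -/
theorem alphaL_lt_of_not_isPermissibleOne {q : ℕ} {A : MvPowerSeries (Fin 2) k} (h : ¬ IsPermissibleOne q A) :
    alphaL (nset A) < q := by
  unfold IsPermissibleOne at h
  push Not at h
  obtain ⟨P, hP, hlt⟩ := h
  exact lt_of_le_of_lt (alphaL_le hP) hlt

/-- If `V(y,u₂)` is NOT permissible for a non-zero label then `ε ≤ q − 1`. -/
theorem epsL_lt_of_not_isPermissibleTwo {q : ℕ} {A : MvPowerSeries (Fin 2) k} (h : ¬ IsPermissibleTwo q A) :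
    epsL (nset A) < q := by
  unfold IsPermissibleTwo at h
  push Not at h
  obtain ⟨P, hP, hlt⟩ := h
  exact lt_of_le_of_lt (epsL_le hP) hlt

/-- Conversely `ε ≥ q` (non-empty support) gives permissibility of `V(y,u₂)`. -/
theorem isPermissibleTwo_of_le_epsL {q : ℕ} {A : MvPowerSeries (Fin 2) k} (h : q ≤ epsL (nset A)) :
    IsPermissibleTwo q A :=
  fun _ hP => le_trans h (epsL_le hP)

/-- And `α ≥ q` gives permissibility of `V(y,u₁)`. -/
theorem isPermissibleOne_of_le_alphaL {q : ℕ} {A : MvPowerSeries (Fin 2) k} (h : q ≤ alphaL (nset A)) :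
    IsPermissibleOne q A :=
  fun _ hP => le_trans h (alphaL_le hP)

end PureDescent

end Summit.ResolutionOfSingularities.ResolutionOfSingularities.Theorems

end
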